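/-
Copyright (c) 2026. All rights reserved.
Released under Apache 2.0 license as described in the file LICENSE.
-/
import Literature.NumberTheory.Automorphic.BrandtModuleSignSpaceDimension
import Mathlib.Algebra.GroupWithZero.Units.Fintype
import HarnessLib

/-!
# Martin's `χ`-admissible `S`-ideal classes: `dim M^χ(O) = #Cl_T(O)^{χ-adm}` (Prop. 7), Cor. 8, the stabiliser criterion,
# and Lemma 10 in weight zero (Martin 2018, §4.4–§4.5)

[tag: quaternion_algebra] [tag: eichler_order] [tag: class_number]

Topic `NumberTheory/Automorphic`. Lane `lit-hodgefound`, seat p12, gen 52 — sequel of `QuaternionicSIdealClasses.lean`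
(`Cl_T(O)`, the sign group `Φ_T`) and `BrandtModuleSignSpaceDimension.lean` (`signCharacter`, `2^{#T} dim M^χ = ∑_g χ(g)
#Fix(Φ_T g)`).

[Martin2018, §4.4]: to a sign pattern `χ` for `𝔐` Martin attaches the signed multigraph `Σ_χ` on `Cl(O)` with an edge
`{x_i, σ_𝔭(x_i)}` of sign `χ_𝔭` for every `𝔭 ∣ 𝔐`; its connected components `X_1, …, X_t` are the `S`-ideal classes, and
"We say `X_i` is `χ`-admissible if there is a partition `X_i = X_i⁺ ⊔ X_i⁻` such that the set of edges in `E_i` which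
connect a vertex in `X_i⁺` with a vertex in `X_i⁻` is precisely `E_i⁻`. … Note that if `χ = +_𝔐`, then `X_i⁺ = X_i` and
`X_i⁻ = ∅` is always a `χ`-admissible partition of `X_i`. Denote the set of `χ`-admissible `X_i ∈ Cl_S(O)` by
`Cl_S(O)^{χ-adm}`.

PROPOSITION 7. … `M_0^χ(O) ≃ {φ : Cl_S(O)^{χ-adm} → ℂ}`. … Thus `dim M_0^χ(O)` is the number of `χ`-admissible classes in
`Cl_S(O)`.  COROLLARY 8. All `X_i ∈ Cl_S(O)` are `χ`-admissible if and only if `dim M_0^χ(O) = dim M_0^{+_𝔐}(O)`."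
[Martin2018, §4.5] "LEMMA 10. Suppose `dim M_0^χ(O) = dim M_0^{χ'}(O)` for any choices of sign patterns `χ, χ'` for `𝔐`.
Then [every] `X_i` is `χ`-admissible …".

Here (DEFINITION `XiSetup.IsAdmissible`, §1) the partition is encoded by its indicator `s : Cls O → {±1}` (`X⁺ = {s = 1}`,
`X⁻ = {s = −1}`): the edge `{x, W_r x}` joins the two parts iff `s(W_r x) = −s(x)`, and it has sign `−1` iff `χ_r = −1`;
so the condition reads `s(W_r x) = χ_r s(x)` for all `x ∈ X`, `r ∈ T`. Results, for every Brandt setup `S`, every finite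
`T`, every `χ : T → {±1}`:

* §1 `isAdmissible_one` (`χ = +_T`: every class admissible), `not_isAdmissible_of_eq_neg_one` (a trivial `W_r` with `χ_r = −1` obstructs),
  `IsAdmissible.apply_atkinLehnerHom` (`s(Φ_T(g) x) = χ(g) s(x)` on `X`);
* §2 (Martin's proof of Prop. 7) `isAdmissible_of_mem_signSpace_of_ne_zero` (`φ ∈ M^χ`, `φ(x_i) ≠ 0` ⇒ admissible, via
  `X^± = {φ = ±φ(x_i)}`), `exists_mem_signSpace_of_isAdmissible` (admissible ⇒ the form `±1` on `X^±`, `0` off `X_i`),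
  **`isAdmissible_iff_exists_mem_signSpace`**, `apply_eq_zero_of_not_isAdmissible` (forms vanish on non-admissible classes);
* §3 **`isAdmissible_iff_forall_stabilizer`** (`X_i` is `χ`-admissible iff `χ(g) = 1` for every `g ∈ (ℤ/2ℤ)^T` fixing a
  point of `X_i` — the signed-graph condition as a condition on the stabiliser);
* §4 ★★★ **`finrank_signSpace_eq_natCard_isAdmissible`** (PROPOSITION 7: `dim M^χ(O) = #Cl_T(O)^{χ-adm}`, by the explicit
  linear isomorphism "restrict `φ` to the base points of the admissible classes"), `natCard_isAdmissible_le`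
  (`#Cl_T^{χ-adm} ≤ h_T`), **`two_pow_mul_natCard_isAdmissible_eq_sum`** (`2^{#T} #Cl_T(O)^{χ-adm} = ∑_g χ(g) #Fix(Φ_T g)`);
* §5 ★ **`forall_isAdmissible_iff_finrank_eq`** (COROLLARY 8), `sum_signCharacter_apply_eq_zero` (dual orthogonality
  `∑_χ χ(g) = 0`, `g ≠ 1`), **`forall_finrank_signSpace_eq_iff_forall_fixedPoints`** (all the `2^{#T}` sign spaces have the
  same dimension iff every `g ≠ 1` acts on `Cls O` without fixed class — the weight-0 hypothesis of Lemma 10 / §4.3), and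
  ★ **`isAdmissible_of_forall_finrank_eq`** (LEMMA 10 in weight `0`: equal dimensions ⇒ every class is `χ`-admissible for
  every `χ`, with `2^{#T} dim M^χ(O) = h`).

## References

* [Martin2018] K. Martin, *Congruences for modular forms mod 2 and quaternionic `S`-ideal classes*, Canad. J. Math. 70
  (2018) 1076–1095 (held: arXiv 1701.07864): §4.3 (4.4) and Lemma 6 (fixed-point-free involutions), §4.4 (`Σ_χ`,
  `χ`-admissible classes, Prop. 7, Cor. 8), §4.5 (Lemma 10, Cor. 11).
* [Martin2018RefinedDimensions] K. Martin, *Refined dimensions of cusp forms …*, J. Number Theory 188 (2018), §3 Prop. 12.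
* [Voight2021] J. Voight, *Quaternion Algebras*, GTM 288 (2021): Prop. 18.5.10, (41.3.5).

## Scope (honest)

Weight `0` only (Martin's Prop. 7 is weight `0`; Lemma 10 is stated for all weights `k` — only its weight-0 case, where it
reduces to Cor. 8, is formalised, and "admissible in weight `k`" is not defined); `F = ℚ`, Eichler level with the level
involutions admitted; rational coefficients. §3's stabiliser criterion is an equivalent reformulation proved here, not a
statement printed by Martin. One definition (`XiSetup.IsAdmissible`), theorems otherwise; no named fact, no instance.
-/

noncomputable section

open scoped Pointwise

namespace Literature.NumberTheory.Automorphic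

namespace Brandt

variable {Nplus Nminus : ℕ} (S : XiSetup Nplus Nminus) (T : Finset ℕ)

/-- The two elements of `ℤ/2ℤ` (multiplicative notation). [folklore] -/
private theorem eq_one_or_eq_ofAdd_one₃ (z : Multiplicative (ZMod 2)) : z = 1 ∨ z = Multiplicative.ofAdd 1 := by
  revert z; decide

/-- In `{±1}`, `a b = 1` forces `a = b`. [folklore] -/
private theorem units_eq_of_mul_eq_one {a b : ℤˣ} (h : a * b = 1) : a = b := by
  calc a = a * (b * b) := by rw [Int.units_mul_self, mul_one]
    _ = b := by rw [← mul_assoc, h, one_mul]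

/-! ## §1 `χ`-admissible `T`-classes -/

/-- **Martin's `χ`-admissible classes**: the `T`-class `X ∈ Cl_T(O)` is `χ`-admissible if it has a partition `X = X⁺ ⊔ X⁻`
such that, among the edges `{x, W_r x}` (`x ∈ X`, `r ∈ T`, sign `χ_r`) of Martin's signed graph `Σ_χ`, those joining `X⁺`
to `X⁻` are exactly the ones of sign `−1` — encoded by the indicator `s = ±1` of the parts: `s(W_r x) = χ_r s(x)` for all
`x ∈ X` and `r ∈ T`. [cite: Martin2018, §4.4 (definition before Prop. 7)] -/
def XiSetup.IsAdmissible (T : Finset ℕ) (χ : T → ℤˣ) (X : S.SClassSet T) : Prop :=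
  ∃ s : ClassSet S.O → ℤˣ, ∀ c : ClassSet S.O, S.sClassOf T c = X → ∀ r : T, s (S.atkinLehner r c) = χ r * s c

variable {T}

/-- Unfolding admissibility. [cite: Martin2018, §4.4] -/
theorem XiSetup.isAdmissible_iff (χ : T → ℤˣ) (X : S.SClassSet T) :
    S.IsAdmissible T χ X ↔
      ∃ s : ClassSet S.O → ℤˣ, ∀ c : ClassSet S.O, S.sClassOf T c = X → ∀ r : T, s (S.atkinLehner r c) = χ r * s c :=
  Iff.rfl

/-- **For the trivial pattern every class is admissible** ("if `χ = +_𝔐`, then `X_i⁺ = X_i` and `X_i⁻ = ∅` is always a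
`χ`-admissible partition"). [cite: Martin2018, §4.4] -/
theorem XiSetup.isAdmissible_one (X : S.SClassSet T) : S.IsAdmissible T 1 X :=
  ⟨fun _ => 1, fun _ _ r => by rw [Pi.one_apply, one_mul]⟩

/-- If `T` contains no prime of `N⁺N⁻` (all `W_r`, `r ∈ T`, trivial: the graph has only loops), a class is `χ`-admissible
iff no loop has sign `−1`, i.e. iff `χ = +_T`; in particular every class is admissible for `χ = +_T` and, when some
`χ_r = −1`, none is. Here: the forward half — loops of sign `−1` obstruct. [cite: Martin2018, §4.4] -/
theorem XiSetup.not_isAdmissible_of_eq_neg_one {χ : T → ℤˣ} {r : T} (hr : ∀ c : ClassSet S.O, S.atkinLehner r c = c)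
    (hχ : χ r = -1) (X : S.SClassSet T) : ¬ S.IsAdmissible T χ X := by
  rintro ⟨s, hs⟩
  obtain ⟨c, rfl⟩ := S.sClassOf_surjective T X
  have h := hs c rfl r
  rw [hr c, hχ] at h
  have h2 : (s c : ℤ) = -(s c : ℤ) := by
    have := congrArg (fun u : ℤˣ => (u : ℤ)) h
    simpa using this
  rcases Int.units_eq_one_or (s c) with h1 | h1 <;> rw [h1] at h2 <;> norm_num at h2

/-- **`s(Φ_T(g) x) = χ(g) s(x)` on an admissible class** (iterate the defining relation along the generators).
[cite: Martin2018, §4.4 (proof of Prop. 7: "the value of `φ(x_j)` is determined by `φ(x_i)` (namely, is `± φ(x_i)`)")] -/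
theorem XiSetup.IsAdmissible.apply_atkinLehnerHom {χ : T → ℤˣ} {X : S.SClassSet T} {s : ClassSet S.O → ℤˣ}
    (hs : ∀ c : ClassSet S.O, S.sClassOf T c = X → ∀ r : T, s (S.atkinLehner r c) = χ r * s c)
    (g : T → Multiplicative (ZMod 2)) {c : ClassSet S.O} (hc : S.sClassOf T c = X) :
    s (S.atkinLehnerHom T g c) = signCharacter T χ g * s c := by
  classical
  suffices key : ∀ (u : Finset T) (c : ClassSet S.O), S.sClassOf T c = X →
      s (S.atkinLehnerHom T (∏ i ∈ u, Pi.mulSingle i (g i)) c) =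
        signCharacter T χ (∏ i ∈ u, Pi.mulSingle i (g i)) * s c by
    have := key Finset.univ c hc
    rwa [Finset.univ_prod_mulSingle] at this
  intro u
  induction u using Finset.induction_on with
  | empty => intro c _; rw [Finset.prod_empty, map_one, map_one, Equiv.Perm.coe_one, id_eq, one_mul]
  | @insert j u hj ih =>
    intro c hc
    rw [Finset.prod_insert hj, map_mul, map_mul, Equiv.Perm.coe_mul, Function.comp_apply]
    have hc' : S.sClassOf T (S.atkinLehnerHom T (∏ i ∈ u, Pi.mulSingle i (g i)) c) = X := by
      rw [S.sClassOf_atkinLehnerHom, hc]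
    rcases eq_one_or_eq_ofAdd_one₃ (g j) with h | h
    · rw [h, Pi.mulSingle_one, map_one, map_one, Equiv.Perm.coe_one, id_eq, one_mul]
      exact ih c hc
    · rw [h, S.atkinLehnerHom_mulSingle, signCharacter_mulSingle_ofAdd_one, hs _ hc' j, ih c hc, mul_assoc]

/-! ## §2 Martin's proof of Proposition 7: admissible classes and forms -/

/-- **A form `φ ∈ M^χ(O)` not vanishing at `x_i` makes the class of `x_i` admissible**: `X⁺ = {x : φ(x) = φ(x_i)}`,
`X⁻ = {x : φ(x) = −φ(x_i)}`. [cite: Martin2018, §4.4 Prop. 7 (proof)] -/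
theorem XiSetup.isAdmissible_of_mem_signSpace_of_ne_zero {χ : T → ℤˣ} {v : ClassSet S.O → ℚ} (hv : v ∈ S.signSpace T χ)
    {c : ClassSet S.O} (hc : v c ≠ 0) : S.IsAdmissible T χ (S.sClassOf T c) := by
  classical
  refine ⟨fun x => if v x = v c then 1 else -1, fun x hx r => ?_⟩
  dsimp only
  -- on the class of `c` the values are `± v c`
  obtain ⟨g, rfl⟩ := (S.sClassOf_eq_sClassOf_iff_exists_atkinLehnerHom T c x).mp hx.symm
  have hvx : v (S.atkinLehnerHom T g c) = v c ∨ v (S.atkinLehnerHom T g c) = -v c := by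
    rw [S.apply_atkinLehnerHom_of_mem_signSpace T hv g c]
    rcases signCharacter_cast_eq T χ g with h | h
    · exact Or.inl (by rw [h, one_mul])
    · exact Or.inr (by rw [h, neg_one_mul])
  set x := S.atkinLehnerHom T g c with hxdef
  have hstep : v (S.atkinLehner r x) = ((χ r : ℤ) : ℚ) * v x := (S.mem_signSpace_iff T χ v).mp hv r x
  have hne : v c ≠ -v c := fun h => hc (by linarith)
  rcases Int.units_eq_one_or (χ r) with h1 | h1
  · -- positive edge: same part
    rw [h1, Units.val_one, Int.cast_one, one_mul] at hstep
    rw [h1, one_mul, hstep]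
  · -- negative edge: opposite parts
    rw [h1, Units.val_neg, Units.val_one, Int.cast_neg, Int.cast_one, neg_one_mul] at hstep
    rw [h1, hstep]
    rcases hvx with h2 | h2
    · rw [h2, if_neg hne.symm, if_pos rfl]; norm_num
    · rw [h2, neg_neg, if_pos rfl, if_neg]
      · norm_num
      · intro h3; exact hne h3.symm

/-- **An admissible class carries a form**: for a `χ`-admissible partition of the class of `c` there is `φ ∈ M^χ(O)` with
`φ = ±1` on `X^±` (normalised `φ(c) = 1`) and `φ = 0` off the class. [cite: Martin2018, §4.4 Prop. 7 (proof: "we can define an element `φ ∈ M_0^χ(O)` by setting `φ(x_j) = ±1` if `x_j ∈ X_i^±` and `φ(x_j) = 0` if `x_j ∉ X_i`")] -/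
theorem XiSetup.exists_mem_signSpace_of_isAdmissible {χ : T → ℤˣ} {c : ClassSet S.O}
    (h : S.IsAdmissible T χ (S.sClassOf T c)) :
    ∃ v ∈ S.signSpace T χ, v c = 1 ∧ (∀ x, S.sClassOf T x = S.sClassOf T c → v x ≠ 0) ∧
      ∀ x, S.sClassOf T x ≠ S.sClassOf T c → v x = 0 := by
  classical
  obtain ⟨s, hs⟩ := h
  refine ⟨fun x => if S.sClassOf T x = S.sClassOf T c then ((s x * s c : ℤˣ) : ℤ) else 0, ?_, ?_, ?_, ?_⟩
  · rw [S.mem_signSpace_iff]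
    intro r x
    by_cases hx : S.sClassOf T x = S.sClassOf T c
    · have hx' : S.sClassOf T (S.atkinLehner r x) = S.sClassOf T c := by rw [S.sClassOf_atkinLehner, hx]
      simp only [if_pos hx, if_pos hx', hs x hx r, Units.val_mul, Int.cast_mul, mul_assoc]
    · have hx' : ¬ S.sClassOf T (S.atkinLehner r x) = S.sClassOf T c := by rwa [S.sClassOf_atkinLehner]
      simp only [if_neg hx, if_neg hx', mul_zero]
  · dsimp only
    rw [if_pos rfl, Int.units_mul_self, Units.val_one, Int.cast_one]
  · intro x hx
    dsimp only
    rw [if_pos hx]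
    exact_mod_cast Units.ne_zero _
  · intro x hx
    dsimp only
    rw [if_neg hx]

/-- **`X_i` is `χ`-admissible iff some `φ ∈ M^χ(O)` has `φ(x_i) ≠ 0`** (the two halves of Martin's proof of Prop. 7).
[cite: Martin2018, §4.4 Prop. 7 (proof: "it suffices to show that … there exists `φ ∈ M_0^χ(O)` such that `φ(x_i) ≠ 0` if and only if `X_i` is `χ`-admissible")] -/
theorem XiSetup.isAdmissible_iff_exists_mem_signSpace (χ : T → ℤˣ) (c : ClassSet S.O) :
    S.IsAdmissible T χ (S.sClassOf T c) ↔ ∃ v ∈ S.signSpace T χ, v c ≠ 0 := by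
  constructor
  · intro h
    obtain ⟨v, hv, h1, -, -⟩ := S.exists_mem_signSpace_of_isAdmissible h
    exact ⟨v, hv, by rw [h1]; exact one_ne_zero⟩
  · rintro ⟨v, hv, hc⟩
    exact S.isAdmissible_of_mem_signSpace_of_ne_zero hv hc

/-- **Forms of sign pattern `χ` vanish identically on the non-admissible classes.** [cite: Martin2018, §4.4 Prop. 7 (proof) and §4.2 (after Lemma 5: "`φ(x_i) = 0` if `σ_𝔭(x_i) = x_i` and `χ_𝔭 = −1`")] -/
theorem XiSetup.apply_eq_zero_of_not_isAdmissible {χ : T → ℤˣ} {v : ClassSet S.O → ℚ} (hv : v ∈ S.signSpace T χ)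
    {c : ClassSet S.O} (h : ¬ S.IsAdmissible T χ (S.sClassOf T c)) : v c = 0 := by
  by_contra hc
  exact h (S.isAdmissible_of_mem_signSpace_of_ne_zero hv hc)

/-- A fixed point of some `W_r` (`r ∈ T`) with `χ_r = −1` makes its class non-admissible (a loop of sign `−1`), so all
forms of pattern `χ` vanish there. [cite: Martin2018, §4.2 (after Lemma 5) and §4.4] -/
theorem XiSetup.not_isAdmissible_of_atkinLehner_eq_self {χ : T → ℤˣ} {r : T} {c : ClassSet S.O}
    (hfix : S.atkinLehner r c = c) (hχ : χ r = -1) : ¬ S.IsAdmissible T χ (S.sClassOf T c) := by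
  rintro ⟨s, hs⟩
  have h := hs c rfl r
  rw [hfix, hχ] at h
  have h2 : (s c : ℤ) = -(s c : ℤ) := by
    have := congrArg (fun u : ℤˣ => (u : ℤ)) h
    simpa using this
  rcases Int.units_eq_one_or (s c) with h1 | h1 <;> rw [h1] at h2 <;> norm_num at h2

/-! ## §3 The stabiliser criterion -/

/-- **`X_i` is `χ`-admissible iff `χ` is trivial on the stabiliser of `x_i` in the sign group `(ℤ/2ℤ)^T`** (closed walks in
`Σ_χ` through `x_i` ↔ group elements fixing `x_i`; a consistent `±` labelling exists iff every closed walk has sign `+1`).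
[cite: Martin2018, §4.4 (the graph `Σ_χ` and Prop. 7)] [cite: Voight2021, Prop. 18.5.10] -/
theorem XiSetup.isAdmissible_iff_forall_stabilizer (χ : T → ℤˣ) (c : ClassSet S.O) :
    S.IsAdmissible T χ (S.sClassOf T c) ↔
      ∀ g : T → Multiplicative (ZMod 2), S.atkinLehnerHom T g c = c → signCharacter T χ g = 1 := by
  constructor
  · rintro ⟨s, hs⟩ g hg
    have h := XiSetup.IsAdmissible.apply_atkinLehnerHom S hs g (c := c) rfl
    rw [hg] at h
    -- `s c = χ(g) s c`
    have : signCharacter T χ g * s c * s c = s c * s c := by rw [← h]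
    rwa [mul_assoc, Int.units_mul_self, mul_one] at this
  · intro h
    -- label `x = Φ(g_x) c` by `χ(g_x)`: well defined modulo the stabiliser, on which `χ = 1`
    have hrep : ∀ x : ClassSet S.O, S.sClassOf T x = S.sClassOf T c → ∃ g, S.atkinLehnerHom T g c = x := fun x hx =>
      (S.sClassOf_eq_sClassOf_iff_exists_atkinLehnerHom T c x).mp hx.symm
    classical
    let gx : ClassSet S.O → (T → Multiplicative (ZMod 2)) := fun x =>
      if hx : S.sClassOf T x = S.sClassOf T c then (hrep x hx).choose else 1
    have hgx : ∀ x (hx : S.sClassOf T x = S.sClassOf T c), S.atkinLehnerHom T (gx x) c = x := fun x hx => by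
      simp only [gx, dif_pos hx]
      exact (hrep x hx).choose_spec
    -- two group elements carrying `c` to the same class point have the same character value
    have hwd : ∀ a b : T → Multiplicative (ZMod 2), S.atkinLehnerHom T a c = S.atkinLehnerHom T b c →
        signCharacter T χ a = signCharacter T χ b := by
      intro a b hab
      have hstab : S.atkinLehnerHom T (a * b) c = c := by
        rw [map_mul, Equiv.Perm.coe_mul, Function.comp_apply, ← hab, ← Function.comp_apply (f := S.atkinLehnerHom T a),
          ← Equiv.Perm.coe_mul, S.atkinLehnerHom_mul_self, Equiv.Perm.coe_one, id_eq]
      have h1 := h (a * b) hstab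
      rw [map_mul] at h1
      exact units_eq_of_mul_eq_one h1
    refine ⟨fun x => signCharacter T χ (gx x), fun x hx r => ?_⟩
    have hx' : S.sClassOf T (S.atkinLehner r x) = S.sClassOf T c := by rw [S.sClassOf_atkinLehner, hx]
    -- `W_r x = Φ(e_r g_x) c` and `= Φ(g_{W_r x}) c`
    have e1 : S.atkinLehnerHom T (Pi.mulSingle r (Multiplicative.ofAdd 1) * gx x) c = S.atkinLehner r x := by
      rw [map_mul, Equiv.Perm.coe_mul, Function.comp_apply, hgx x hx, S.atkinLehnerHom_mulSingle]
    have e2 : S.atkinLehnerHom T (gx (S.atkinLehner r x)) c = S.atkinLehner r x := hgx _ hx'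
    show signCharacter T χ (gx (S.atkinLehner r x)) = χ r * signCharacter T χ (gx x)
    rw [hwd _ _ (e2.trans e1.symm), map_mul, signCharacter_mulSingle_ofAdd_one]

/-- Admissibility of a class does not depend on the chosen base point (restated for `Φ_T(g) c`). [cite: Martin2018, §4.4] -/
theorem XiSetup.isAdmissible_sClassOf_atkinLehnerHom_iff (χ : T → ℤˣ) (g : T → Multiplicative (ZMod 2)) (c : ClassSet S.O) :
    S.IsAdmissible T χ (S.sClassOf T (S.atkinLehnerHom T g c)) ↔ S.IsAdmissible T χ (S.sClassOf T c) := by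
  rw [S.sClassOf_atkinLehnerHom]

/-! ## §4 Proposition 7: `dim M^χ(O)` is the number of `χ`-admissible classes -/

/-- **MARTIN'S PROPOSITION 7: `dim M^χ(O) = #Cl_T(O)^{χ-adm}`** — restriction of forms to base points of the admissible
`T`-classes is a linear isomorphism `M^χ(O) ≃ {f : Cl_T(O)^{χ-adm} → ℚ}` (injective: a form is `± φ(x_i)` on `X_i` and
`0` on the non-admissible classes; surjective: the forms `±1` on `X_i^±`). For every Eichler order of a definite
quaternion algebra over `ℚ`, every finite `T`, every sign pattern `χ`. [cite: Martin2018, §4.4 Prop. 7] -/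
theorem XiSetup.finrank_signSpace_eq_natCard_isAdmissible (χ : T → ℤˣ) :
    Module.finrank ℚ (S.signSpace T χ) = Nat.card {X : S.SClassSet T // S.IsAdmissible T χ X} := by
  classical
  haveI := S.finite_sClassSet T
  letI : Fintype {X : S.SClassSet T // S.IsAdmissible T χ X} := Fintype.ofFinite _
  -- base points
  let ρ : S.SClassSet T → ClassSet S.O := fun X => (S.sClassOf_surjective T X).choose
  have hρ : ∀ X, S.sClassOf T (ρ X) = X := fun X => (S.sClassOf_surjective T X).choose_spec
  -- the restriction map
  let L : S.signSpace T χ →ₗ[ℚ] ({X : S.SClassSet T // S.IsAdmissible T χ X} → ℚ) :=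
    { toFun := fun v X => (v : ClassSet S.O → ℚ) (ρ X.1)
      map_add' := fun v w => rfl
      map_smul' := fun a v => rfl }
  have hL : ∀ (v : S.signSpace T χ) X, L v X = (v : ClassSet S.O → ℚ) (ρ X.1) := fun _ _ => rfl
  -- injective
  have hinj : Function.Injective L := by
    intro v w hvw
    apply Subtype.ext
    funext x
    have hsub : ((v - w : S.signSpace T χ) : ClassSet S.O → ℚ) x = 0 := by
      have hmem : ((v - w : S.signSpace T χ) : ClassSet S.O → ℚ) ∈ S.signSpace T χ := (v - w).2
      by_cases hadm : S.IsAdmissible T χ (S.sClassOf T x)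
      · -- `x = Φ(g) (ρ X)`, value `χ(g)` times the value at the base point, which is `0`
        have hx : S.sClassOf T (ρ (S.sClassOf T x)) = S.sClassOf T x := hρ _
        obtain ⟨g, hg⟩ := (S.sClassOf_eq_sClassOf_iff_exists_atkinLehnerHom T (ρ (S.sClassOf T x)) x).mp hx
        rw [← hg, S.apply_atkinLehnerHom_of_mem_signSpace T hmem g]
        have h0 : ((v - w : S.signSpace T χ) : ClassSet S.O → ℚ) (ρ (S.sClassOf T x)) = 0 := by
          have := congrFun hvw ⟨S.sClassOf T x, hadm⟩
          rw [hL, hL] at this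
          rw [Submodule.coe_sub, Pi.sub_apply, this, sub_self]
        rw [h0, mul_zero]
      · exact S.apply_eq_zero_of_not_isAdmissible hmem hadm
    rw [Submodule.coe_sub, Pi.sub_apply] at hsub
    linarith
  -- surjective
  have hsurj : Function.Surjective L := by
    intro f
    -- a form for each admissible class, normalised at its base point
    have hform : ∀ X : {X : S.SClassSet T // S.IsAdmissible T χ X}, ∃ v ∈ S.signSpace T χ, v (ρ X.1) = 1 ∧
        (∀ x, S.sClassOf T x = S.sClassOf T (ρ X.1) → v x ≠ 0) ∧ ∀ x, S.sClassOf T x ≠ S.sClassOf T (ρ X.1) → v x = 0 :=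
      fun X => S.exists_mem_signSpace_of_isAdmissible (by rw [hρ]; exact X.2)
    choose vX hvXmem hvX1 _ hvX0 using hform
    refine ⟨∑ X, f X • (⟨vX X, hvXmem X⟩ : S.signSpace T χ), funext fun Y => ?_⟩
    rw [map_sum]
    simp only [map_smul, Finset.sum_apply, Pi.smul_apply, hL, smul_eq_mul]
    rw [Finset.sum_eq_single Y]
    · rw [hvX1, mul_one]
    · intro X _ hXY
      rw [hvX0 X (ρ Y.1), mul_zero]
      rw [hρ, hρ]
      exact fun h => hXY.symm (Subtype.ext h)
    · intro h; exact absurd (Finset.mem_univ Y) h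
  have e := LinearEquiv.ofBijective L ⟨hinj, hsurj⟩
  rw [e.finrank_eq, Module.finrank_fintype_fun_eq_card, Nat.card_eq_fintype_card]

/-- `#Cl_T(O)^{χ-adm} ≤ h_T`. [cite: Martin2018, §4.4 Prop. 7 and Cor. 8] -/
theorem XiSetup.natCard_isAdmissible_le (χ : T → ℤˣ) :
    Nat.card {X : S.SClassSet T // S.IsAdmissible T χ X} ≤ Nat.card (S.SClassSet T) := by
  haveI := S.finite_sClassSet T
  exact Finite.card_subtype_le _

/-- **`2^{#T} · #Cl_T(O)^{χ-adm} = ∑_g χ(g) #Fix(Φ_T g)`** (Prop. 7 combined with Prop. 12 of the companion file).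
[cite: Martin2018, §4.4 Prop. 7] [cite: Martin2018RefinedDimensions, §3 Prop. 12] -/
theorem XiSetup.two_pow_mul_natCard_isAdmissible_eq_sum (χ : T → ℤˣ) :
    (2 : ℚ) ^ T.card * Nat.card {X : S.SClassSet T // S.IsAdmissible T χ X} =
      ∑ g : T → Multiplicative (ZMod 2),
        ((signCharacter T χ g : ℤ) : ℚ) * Nat.card {c : ClassSet S.O // S.atkinLehnerHom T g c = c} := by
  rw [← S.finrank_signSpace_eq_natCard_isAdmissible χ]
  exact S.two_pow_mul_finrank_signSpace_eq_sum T χ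

/-! ## §5 Corollary 8 and Lemma 10 (weight zero) -/

/-- **MARTIN'S COROLLARY 8: all classes of `Cl_T(O)` are `χ`-admissible iff `dim M^χ(O) = dim M^{+_T}(O)`.**
[cite: Martin2018, §4.4 Cor. 8] -/
theorem XiSetup.forall_isAdmissible_iff_finrank_eq (χ : T → ℤˣ) :
    (∀ X : S.SClassSet T, S.IsAdmissible T χ X) ↔
      Module.finrank ℚ (S.signSpace T χ) = Module.finrank ℚ (S.signSpace T 1) := by
  classical
  haveI := S.finite_sClassSet T
  letI : Fintype (S.SClassSet T) := Fintype.ofFinite _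
  rw [S.finrank_signSpace_eq_natCard_isAdmissible χ, S.finrank_signSpace_one_eq_natCard_sClassSet T,
    Nat.card_eq_fintype_card, Nat.card_eq_fintype_card, Fintype.card_subtype, Finset.card_eq_iff_eq_univ,
    Finset.eq_univ_iff_forall]
  simp only [Finset.mem_filter, Finset.mem_univ, true_and]

/-- Cor. 8 with `h_T`: all classes admissible iff `dim M^χ(O) = #Cl_T(O)`. [cite: Martin2018, §4.4 Cor. 8 and (3.9)] -/
theorem XiSetup.forall_isAdmissible_iff_finrank_eq_natCard (χ : T → ℤˣ) :
    (∀ X : S.SClassSet T, S.IsAdmissible T χ X) ↔ Module.finrank ℚ (S.signSpace T χ) = Nat.card (S.SClassSet T) := by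
  rw [S.forall_isAdmissible_iff_finrank_eq χ, S.finrank_signSpace_one_eq_natCard_sClassSet T]

variable (T)

/-- **Dual orthogonality: `∑_χ χ(g) = 0` for `g ≠ 1`** (flip the sign of `χ` at a coordinate where `g ≠ 0`).
[cite: Martin2018RefinedDimensions, §3 Lemma 11] -/
theorem sum_signCharacter_apply_eq_zero {g : T → Multiplicative (ZMod 2)} (hg : g ≠ 1) :
    ∑ χ : T → ℤˣ, ((signCharacter T χ g : ℤ) : ℚ) = 0 := by
  classical
  obtain ⟨r, hr⟩ : ∃ r, g r ≠ 1 := by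
    by_contra hall
    push Not at hall
    exact hg (funext hall)
  have hr' : g r = Multiplicative.ofAdd 1 := (eq_one_or_eq_ofAdd_one₃ (g r)).resolve_left hr
  -- flipping `χ_r` negates `χ(g)`
  let δ : T → ℤˣ := Function.update 1 r (-1)
  have hδ : signCharacter T δ g = -1 := by
    rw [signCharacter_apply, Finset.prod_eq_single r]
    · rw [if_neg hr]; simp [δ]
    · intro r' _ hr'r
      by_cases h : g r' = 1
      · rw [if_pos h]
      · rw [if_neg h]; simp [δ, Function.update_of_ne hr'r]
    · intro h; exact absurd (Finset.mem_univ r) h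
  have key : ∑ χ : T → ℤˣ, ((signCharacter T χ g : ℤ) : ℚ) = ∑ χ : T → ℤˣ, ((signCharacter T (χ * δ) g : ℤ) : ℚ) :=
    (Fintype.sum_equiv (Equiv.mulRight δ) _ _ fun _ => rfl).symm
  have hneg : ∀ χ : T → ℤˣ, ((signCharacter T (χ * δ) g : ℤ) : ℚ) = -((signCharacter T χ g : ℤ) : ℚ) := fun χ => by
    rw [signCharacter_mul, hδ, Units.val_mul, Units.val_neg, Units.val_one, Int.cast_mul, Int.cast_neg, Int.cast_one]
    ring
  simp only [hneg, Finset.sum_neg_distrib] at key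
  linarith

/-- `∑_χ χ(1) = 2^{#T}` (the number of sign patterns). [cite: Martin2018RefinedDimensions, §3 Lemma 11] -/
theorem sum_signCharacter_apply_one :
    ∑ χ : T → ℤˣ, ((signCharacter T χ 1 : ℤ) : ℚ) = 2 ^ T.card := by
  simp only [map_one, Units.val_one, Int.cast_one, Finset.sum_const, Finset.card_univ, nsmul_eq_mul, mul_one]
  rw [Fintype.card_fun, Fintype.card_units_int, Fintype.card_coe]
  push_cast
  ring

/-- **All `2^{#T}` sign spaces have the same dimension iff every `g ≠ 1` of the sign group acts on `Cls O` without fixed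
class** — the weight-`0` content of Martin's equidistribution hypothesis (for one prime: "`σ_𝔭` acts without fixed points
if and only if `dim M^{+_𝔭} = dim M^{−_𝔭}`" in `M_0(O)`, (4.4)); then `2^{#T} dim M^χ(O) = h` for every `χ`.
[cite: Martin2018, §4.3 (4.4) and §4.5 Lemma 10 (hypothesis)] [cite: Martin2018RefinedDimensions, §3 Prop. 12] -/
theorem XiSetup.forall_finrank_signSpace_eq_iff_forall_fixedPoints :
    (∀ χ : T → ℤˣ, (2 : ℚ) ^ T.card * Module.finrank ℚ (S.signSpace T χ) = Nat.card (ClassSet S.O)) ↔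
      ∀ g : T → Multiplicative (ZMod 2), g ≠ 1 → Nat.card {c : ClassSet S.O // S.atkinLehnerHom T g c = c} = 0 := by
  classical
  haveI : Fintype (ClassSet S.O) := Fintype.ofFinite _
  have hfix1 : Nat.card {c : ClassSet S.O // S.atkinLehnerHom T 1 c = c} = Nat.card (ClassSet S.O) :=
    Nat.card_congr (Equiv.subtypeUnivEquiv fun c => by rw [map_one, Equiv.Perm.coe_one, id_eq])
  constructor
  · intro h g hg
    -- `#Fix(g) = ∑_χ χ(g) dim M^χ = (h / 2^{#T}) ∑_χ χ(g) = 0`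
    have hd : ∀ χ : T → ℤˣ, (Module.finrank ℚ (S.signSpace T χ) : ℚ) = Nat.card (ClassSet S.O) / 2 ^ T.card :=
      fun χ => by
      rw [eq_div_iff (pow_ne_zero _ two_ne_zero), mul_comm]; exact h χ
    have key := S.natCard_fixedPoints_atkinLehnerHom_eq_sum T g
    simp only [hd, ← Finset.sum_mul, sum_signCharacter_apply_eq_zero T hg, zero_mul] at key
    exact_mod_cast key
  · intro h χ
    rw [S.two_pow_mul_finrank_signSpace_eq_sum T χ, Finset.sum_eq_single (1 : T → Multiplicative (ZMod 2))]
    · rw [map_one, Units.val_one, Int.cast_one, one_mul, hfix1]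
    · intro g _ hg
      rw [h g hg, Nat.cast_zero, mul_zero]
    · intro h1; exact absurd (Finset.mem_univ _) h1

/-- **MARTIN'S LEMMA 10 IN WEIGHT ZERO: if all the sign spaces `M^χ(O)`, `χ : T → {±1}`, have the same dimension, then
every class of `Cl_T(O)` is `χ`-admissible for every `χ`**, and `2^{#T} dim M^χ(O) = h`. [cite: Martin2018, §4.5 Lemma 10] -/
theorem XiSetup.isAdmissible_of_forall_finrank_eq
    (h : ∀ χ χ' : T → ℤˣ, Module.finrank ℚ (S.signSpace T χ) = Module.finrank ℚ (S.signSpace T χ'))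
    (χ : T → ℤˣ) (X : S.SClassSet T) : S.IsAdmissible T χ X :=
  (S.forall_isAdmissible_iff_finrank_eq χ).mpr (h χ 1) X

/-- Under the hypothesis of Lemma 10, `2^{#T} · dim M^χ(O) = h` for every `χ` ("the sign patterns are perfectly
equidistributed"). [cite: Martin2018, §4.5 Lemma 10 (proof)] [cite: Martin2018RefinedDimensions, §3] -/
theorem XiSetup.two_pow_mul_finrank_signSpace_eq_of_forall_finrank_eq
    (h : ∀ χ χ' : T → ℤˣ, Module.finrank ℚ (S.signSpace T χ) = Module.finrank ℚ (S.signSpace T χ')) (χ : T → ℤˣ) :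
    2 ^ T.card * Module.finrank ℚ (S.signSpace T χ) = Nat.card (ClassSet S.O) := by
  classical
  have hsum := S.sum_finrank_signSpace T
  rw [Finset.sum_congr rfl fun χ' _ => h χ' χ, Finset.sum_const, Finset.card_univ, smul_eq_mul, Fintype.card_fun,
    Fintype.card_units_int, Fintype.card_coe] at hsum
  exact hsum

/-- Under the hypothesis of Lemma 10 every `g ≠ 1` of the sign group acts on `Cls O` without fixed class (so every
`T`-class has exactly `2^{#T}` elements). [cite: Martin2018, §4.3 Lemma 6 and §4.5 Lemma 10] -/
theorem XiSetup.natCard_fixedPoints_eq_zero_of_forall_finrank_eq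
    (h : ∀ χ χ' : T → ℤˣ, Module.finrank ℚ (S.signSpace T χ) = Module.finrank ℚ (S.signSpace T χ'))
    {g : T → Multiplicative (ZMod 2)} (hg : g ≠ 1) : Nat.card {c : ClassSet S.O // S.atkinLehnerHom T g c = c} = 0 := by
  refine (S.forall_finrank_signSpace_eq_iff_forall_fixedPoints T).mp (fun χ => ?_) g hg
  exact_mod_cast S.two_pow_mul_finrank_signSpace_eq_of_forall_finrank_eq T h χ

end Brandt

end Literature.NumberTheory.Automorphic
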